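import Summits.Ventures.LatticeQCDFlow.TrivializingMaps.WilsonVarianceExtensive
import Literature.MathematicalPhysics.QuantumLattice.GaugeGroupsProofs

/-!
HONEST FRAMING: exact (Metropolis-corrected) sampling algorithms for lattice gauge theory; figures
of merit are autocorrelation/cost numbers at stated couplings and volumes; no continuum-physics
claim.

# HaarTraceMomentsSUn — `∫_{SU(n)} |tr g|² dg = 1`, `∫ (tr g)² dg = 0` (`n ≥ 3`), hence
# `m₂(n) = ∫ (Re tr g)² dg = ½` and the EXPLICIT volume-uniform Fisher-zero disc `|s| < 512(2n+1)`
# for the `SU(n)` Wilson theory, `n ≥ 3` (lean-2 GEN-6, ours)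

Venture-side (OURS).  Cell `lqcd-flow` (pub-lqcd), unit `pub-lqcd-lean-2-g6`, 2026-08-22.  Completes
`WilsonVarianceExtensive` (`R₀(n) = max 1 (256(2n+1)/m₂(n))` with `m₂(n)` unevaluated) and
`WilsonSU2FisherZeroRadius` (`m₂(2) = 1`) by evaluating the Haar second moments of the trace for
`n ≥ 3` WITHOUT Peter–Weyl: only translation invariance of Haar under the explicit `SU(n)` elements of
the tree's `Literature.MathematicalPhysics.QuantumLattice.GaugeGroupsProofs` (the diagonal circles
`diagonal (pairFun k l w)` and the signed transpositions `sSwapMatrix a b`) and the central elements.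

* `integral_normSq_entry_eq_of_ne` (right invariance under `sSwap a b`: `E|U_ia|² = E|U_ib|²`),
  `sum_normSq_row_SU` (`∑_j |U_ij|² = 1`), **`integral_normSq_entry`** (`E|U_ij|² = 1/n`);
* `integral_diag_mul_conj_diag_eq_zero` (`E[U_ii conj U_kk] = 0`, `i ≠ k`: left invariance under
  `diag(…, i, …, -i, …)`), **`integral_normSq_trace`** (`E|tr U|² = 1`, `n ≥ 1`);
* `integral_trace_sq_eq_zero` (`E (tr U)² = 0` for `n ≥ 3`: the central element `e^{2πi/n}` has
  square `≠ 1`), **`haarSqReTrace_eq_half`** (`m₂(n) = ½`, `n ≥ 3`);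
* **`wilson_sun_exists_fisherZero_norm_lt`** — for `n ≥ 3`, `d ≥ 2` and EVERY `L ≥ 2` the `SU(n)`
  Wilson partition function has a Fisher zero with `|s₀| < 512(2n+1)`, and
  **`wilson_sun_theoremA_radius_le`** — every THEOREM-A volume-uniform radius is `≤ 512(2n+1)`.

NOT CLAIMED: sharpness (off by ~10³ against printed zero locations); `L = 1`; cost statements.
-/

open MeasureTheory ProbabilityTheory Filter Topology Complex Set Metric
open Literature.MathematicalPhysics.QuantumFieldTheory
open Literature.MathematicalPhysics.QuantumFieldTheory.Luscher2010
open Literature.MathematicalPhysics.QuantumFieldTheory.WilsonFlow (coeConfig continuous_coeConfig)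
open Literature.MathematicalPhysics.QuantumLattice (pairFun sSwapMatrix sSwapMatrix_mem
  diagonal_pairFun_mem)
open scoped Matrix Matrix.Norms.Frobenius ContDiff ComplexConjugate

namespace Summit.Ventures.LatticeQCDFlow.TrivializingMaps

section Haar

variable {n : ℕ}

/-- Continuous complex functions on `SU(n)` are Haar-integrable. [folklore] -/
theorem integrable_haarSU_of_continuous {f : Matrix.specialUnitaryGroup (Fin n) ℂ → ℂ}
    (hf : Continuous f) :
    Integrable f (haarProbability (Matrix.specialUnitaryGroup (Fin n) ℂ)) := by
  haveI : SecondCountableTopology (Matrix (Fin n) (Fin n) ℂ) :=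
    inferInstanceAs (SecondCountableTopology (Fin n → Fin n → ℂ))
  haveI : SecondCountableTopology (Matrix.specialUnitaryGroup (Fin n) ℂ) :=
    Topology.IsEmbedding.subtypeVal.secondCountableTopology
  exact (BoundedContinuousFunction.mkOfCompact ⟨_, hf⟩).integrable _

/-- Continuous real functions on `SU(n)` are Haar-integrable. [folklore] -/
theorem integrable_haarSU_of_continuous_real {f : Matrix.specialUnitaryGroup (Fin n) ℂ → ℝ}
    (hf : Continuous f) :
    Integrable f (haarProbability (Matrix.specialUnitaryGroup (Fin n) ℂ)) := by
  haveI : SecondCountableTopology (Matrix (Fin n) (Fin n) ℂ) :=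
    inferInstanceAs (SecondCountableTopology (Fin n → Fin n → ℂ))
  haveI : SecondCountableTopology (Matrix.specialUnitaryGroup (Fin n) ℂ) :=
    Topology.IsEmbedding.subtypeVal.secondCountableTopology
  exact (BoundedContinuousFunction.mkOfCompact ⟨_, hf⟩).integrable _

/-- A matrix entry is a continuous function on `SU(n)`. [folklore] -/
theorem continuous_SU_entry (i j : Fin n) :
    Continuous fun U : Matrix.specialUnitaryGroup (Fin n) ℂ => (U : Matrix (Fin n) (Fin n) ℂ) i j :=
  (continuous_apply_apply i j).comp continuous_subtype_val

/-- **Column symmetry of the entry moments**: `∫ |U_ia|² = ∫ |U_ib|²` (right invariance of Haar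
under the signed transposition `sSwap a b ∈ SU(n)`; `(U·sSwap a b)_{ia} = U_{ib}`). [folklore] -/
theorem integral_normSq_entry_eq_of_ne (i : Fin n) {a b : Fin n} (hab : a ≠ b) :
    ∫ U, Complex.normSq ((U : Matrix (Fin n) (Fin n) ℂ) i a)
        ∂(haarProbability (Matrix.specialUnitaryGroup (Fin n) ℂ)) =
      ∫ U, Complex.normSq ((U : Matrix (Fin n) (Fin n) ℂ) i b)
        ∂(haarProbability (Matrix.specialUnitaryGroup (Fin n) ℂ)) := by
  set S : Matrix.specialUnitaryGroup (Fin n) ℂ := ⟨sSwapMatrix a b, sSwapMatrix_mem a b⟩ with hSdef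
  have key := integral_mul_right_eq_self (μ := haarProbability (Matrix.specialUnitaryGroup (Fin n) ℂ))
    (fun U : Matrix.specialUnitaryGroup (Fin n) ℂ => Complex.normSq ((U : Matrix (Fin n) (Fin n) ℂ) i a)) S
  have hentry : ∀ U : Matrix.specialUnitaryGroup (Fin n) ℂ,
      ((U * S : Matrix.specialUnitaryGroup (Fin n) ℂ) : Matrix (Fin n) (Fin n) ℂ) i a =
        (U : Matrix (Fin n) (Fin n) ℂ) i b := fun U => by
    show ((U : Matrix (Fin n) (Fin n) ℂ) * sSwapMatrix a b) i a = _
    unfold sSwapMatrix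
    rw [if_neg hab, ← mul_assoc, Matrix.mul_swap_apply_left, Matrix.mul_diagonal,
      Function.update_of_ne (Ne.symm hab), Pi.one_apply, mul_one]
  simp only [hentry] at key
  exact key.symm

/-- **Rows of a unitary matrix have unit norm**: `∑_j |U_ij|² = 1` on `SU(n)`. [folklore] -/
theorem sum_normSq_row_SU (U : Matrix.specialUnitaryGroup (Fin n) ℂ) (i : Fin n) :
    ∑ j, Complex.normSq ((U : Matrix (Fin n) (Fin n) ℂ) i j) = 1 := by
  have hU : (U : Matrix (Fin n) (Fin n) ℂ) * star (U : Matrix (Fin n) (Fin n) ℂ) = 1 :=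
    Matrix.mem_unitaryGroup_iff.mp (Matrix.mem_specialUnitaryGroup_iff.mp U.2).1
  have h := congrFun (congrFun hU i) i
  rw [Matrix.mul_apply, Matrix.one_apply_eq] at h
  have h' : ∑ j, ((Complex.normSq ((U : Matrix (Fin n) (Fin n) ℂ) i j) : ℝ) : ℂ) = 1 := by
    rw [← h]
    refine Finset.sum_congr rfl fun j _ => ?_
    rw [Matrix.star_apply, Complex.star_def, Complex.mul_conj]
  exact_mod_cast h'

/-- **`∫_{SU(n)} |U_ij|² dU = 1/n`** (`n ≥ 1`). [folklore] -/
theorem integral_normSq_entry (hn : 1 ≤ n) (i j : Fin n) :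
    ∫ U, Complex.normSq ((U : Matrix (Fin n) (Fin n) ℂ) i j)
        ∂(haarProbability (Matrix.specialUnitaryGroup (Fin n) ℂ)) = 1 / n := by
  set μ := haarProbability (Matrix.specialUnitaryGroup (Fin n) ℂ) with hμ
  have hall : ∀ j' : Fin n, ∫ U, Complex.normSq ((U : Matrix (Fin n) (Fin n) ℂ) i j') ∂μ =
      ∫ U, Complex.normSq ((U : Matrix (Fin n) (Fin n) ℂ) i j) ∂μ := fun j' => by
    by_cases h : j' = j
    · rw [h]
    · exact integral_normSq_entry_eq_of_ne i h
  have hint : ∀ j' : Fin n, Integrable (fun U : Matrix.specialUnitaryGroup (Fin n) ℂ =>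
      Complex.normSq ((U : Matrix (Fin n) (Fin n) ℂ) i j')) μ := fun j' =>
    integrable_haarSU_of_continuous_real (Complex.continuous_normSq.comp (continuous_SU_entry i j'))
  have hsum : ∑ j', ∫ U, Complex.normSq ((U : Matrix (Fin n) (Fin n) ℂ) i j') ∂μ = 1 := by
    rw [← integral_finsetSum _ fun j' _ => hint j']
    simp only [sum_normSq_row_SU, integral_const, smul_eq_mul, probReal_univ, one_mul]
  simp only [hall, Finset.sum_const, Finset.card_univ, Fintype.card_fin, nsmul_eq_mul] at hsum
  have hn0 : (n : ℝ) ≠ 0 := by exact_mod_cast (show n ≠ 0 by omega)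
  field_simp
  linarith

/-- **Off-diagonal decorrelation**: `∫ U_ii · conj(U_kk) dU = 0` for `i ≠ k` (left invariance under
the diagonal element with `i` at `i` and `-i = i⁻¹` at `k`: the integrand picks up the factor
`i · conj(-i) = -1`). [folklore] -/
theorem integral_diag_mul_conj_diag_eq_zero {i k : Fin n} (hik : i ≠ k) :
    ∫ U, (U : Matrix (Fin n) (Fin n) ℂ) i i * conj ((U : Matrix (Fin n) (Fin n) ℂ) k k)
      ∂(haarProbability (Matrix.specialUnitaryGroup (Fin n) ℂ)) = 0 := by
  set μ := haarProbability (Matrix.specialUnitaryGroup (Fin n) ℂ) with hμ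
  set w : Circle := ⟨I, by simp [Submonoid.unitSphere]⟩ with hwdef
  have hwI : (w : ℂ) = I := rfl
  set D : Matrix.specialUnitaryGroup (Fin n) ℂ :=
    ⟨Matrix.diagonal (pairFun i k (w : ℂ)), diagonal_pairFun_mem i k w⟩ with hDdef
  have hDi : pairFun i k (w : ℂ) i = I := by
    simp [pairFun, hwI, hik]
  have hDk : pairFun i k (w : ℂ) k = -I := by
    simp [pairFun, hwI, hik.symm, Complex.inv_I]
  have key := integral_mul_left_eq_self (μ := μ)
    (fun U : Matrix.specialUnitaryGroup (Fin n) ℂ =>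
      (U : Matrix (Fin n) (Fin n) ℂ) i i * conj ((U : Matrix (Fin n) (Fin n) ℂ) k k)) D
  have hent : ∀ (U : Matrix.specialUnitaryGroup (Fin n) ℂ) (m : Fin n),
      ((D * U : Matrix.specialUnitaryGroup (Fin n) ℂ) : Matrix (Fin n) (Fin n) ℂ) m m =
        pairFun i k (w : ℂ) m * (U : Matrix (Fin n) (Fin n) ℂ) m m := fun U m => by
    show (Matrix.diagonal (pairFun i k (w : ℂ)) * (U : Matrix (Fin n) (Fin n) ℂ)) m m = _
    rw [Matrix.diagonal_mul]
  simp only [hent, hDi, hDk, map_mul, map_neg, Complex.conj_I, neg_neg] at key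
  -- key : ∫ (I * U_ii) * (I * conj U_kk) = ∫ U_ii conj U_kk, and the LHS is `-` the RHS
  have hneg : ∫ U, I * (U : Matrix (Fin n) (Fin n) ℂ) i i *
      (I * conj ((U : Matrix (Fin n) (Fin n) ℂ) k k)) ∂μ =
      -∫ U, (U : Matrix (Fin n) (Fin n) ℂ) i i * conj ((U : Matrix (Fin n) (Fin n) ℂ) k k) ∂μ := by
    rw [← integral_neg]
    refine integral_congr_ae (ae_of_all _ fun U => ?_)
    have : I * I = -1 := Complex.I_mul_I
    linear_combination ((U : Matrix (Fin n) (Fin n) ℂ) i i * conj ((U : Matrix (Fin n) (Fin n) ℂ) k k)) * this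
  rw [hneg] at key
  -- -x = x ⇒ x = 0
  linear_combination (-(1 : ℂ) / 2) * key

/-- **`∫_{SU(n)} |tr U|² dU = 1`** (`n ≥ 1`). [folklore] -/
theorem integral_normSq_trace (hn : 1 ≤ n) :
    ∫ U, Complex.normSq ((U : Matrix (Fin n) (Fin n) ℂ)).trace
      ∂(haarProbability (Matrix.specialUnitaryGroup (Fin n) ℂ)) = 1 := by
  set μ := haarProbability (Matrix.specialUnitaryGroup (Fin n) ℂ) with hμ
  -- work in ℂ: tr * conj tr = Σ_k Σ_i U_ii conj U_kk
  have hexp : ∀ U : Matrix.specialUnitaryGroup (Fin n) ℂ,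
      ((U : Matrix (Fin n) (Fin n) ℂ)).trace * conj ((U : Matrix (Fin n) (Fin n) ℂ)).trace =
        ∑ k, ∑ i, (U : Matrix (Fin n) (Fin n) ℂ) i i * conj ((U : Matrix (Fin n) (Fin n) ℂ) k k) :=
    fun U => by
      simp only [Matrix.trace, Matrix.diag_apply, map_sum, Finset.sum_mul, Finset.mul_sum]
  have hint : ∀ i k : Fin n, Integrable (fun U : Matrix.specialUnitaryGroup (Fin n) ℂ =>
      (U : Matrix (Fin n) (Fin n) ℂ) i i * conj ((U : Matrix (Fin n) (Fin n) ℂ) k k)) μ := fun i k =>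
    integrable_haarSU_of_continuous ((continuous_SU_entry i i).mul
      (Complex.continuous_conj.comp (continuous_SU_entry k k)))
  have hdiag : ∀ k : Fin n, ∑ i, ∫ U, (U : Matrix (Fin n) (Fin n) ℂ) i i *
      conj ((U : Matrix (Fin n) (Fin n) ℂ) k k) ∂μ = ((1 / n : ℝ) : ℂ) := fun k => by
    rw [Finset.sum_eq_single k (fun i _ hik => integral_diag_mul_conj_diag_eq_zero hik)
      (fun h => absurd (Finset.mem_univ k) h)]
    simp_rw [Complex.mul_conj]
    rw [integral_complex_ofReal, integral_normSq_entry hn k k]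
  have hC : ∫ U, ((U : Matrix (Fin n) (Fin n) ℂ)).trace * conj ((U : Matrix (Fin n) (Fin n) ℂ)).trace ∂μ
      = 1 := by
    simp only [hexp]
    rw [integral_finsetSum _ fun k _ => integrable_finsetSum _ fun i _ => hint i k]
    simp_rw [integral_finsetSum _ fun i _ => hint i _]
    simp only [hdiag, Finset.sum_const, Finset.card_univ, Fintype.card_fin, nsmul_eq_mul]
    have hn0 : (n : ℂ) ≠ 0 := by exact_mod_cast (show n ≠ 0 by omega)
    push_cast
    field_simp
  have h2 : ∫ U, ((Complex.normSq ((U : Matrix (Fin n) (Fin n) ℂ)).trace : ℝ) : ℂ) ∂μ = 1 := by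
    rw [← hC]
    refine integral_congr_ae (ae_of_all _ fun U => ?_)
    simp only [Complex.mul_conj]
  rw [integral_complex_ofReal] at h2
  exact_mod_cast h2

/-- **`∫_{SU(n)} (tr U)² dU = 0` for `n ≥ 3`** (left invariance under the central element
`ζ = e^{2πi/n}`: the integrand picks up `ζ²`, and `ζ² ≠ 1` when `n ≥ 3`). [folklore] -/
theorem integral_trace_sq_eq_zero (hn : 3 ≤ n) :
    ∫ U, ((U : Matrix (Fin n) (Fin n) ℂ)).trace ^ 2
      ∂(haarProbability (Matrix.specialUnitaryGroup (Fin n) ℂ)) = 0 := by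
  set μ := haarProbability (Matrix.specialUnitaryGroup (Fin n) ℂ) with hμ
  set ζ : ℂ := Complex.exp (2 * Real.pi * I / n) with hζdef
  have hn0 : (n : ℂ) ≠ 0 := by exact_mod_cast (show n ≠ 0 by omega)
  -- ζ² ≠ 1
  have hζ2 : ζ ^ 2 ≠ 1 := by
    intro h
    rw [hζdef, ← Complex.exp_nat_mul, Complex.exp_eq_one_iff] at h
    obtain ⟨k, hk⟩ := h
    have h2 : (2 * Real.pi * I : ℂ) ≠ 0 := by simp [Real.pi_ne_zero, Complex.I_ne_zero]
    have h3 : ((2 : ℕ) : ℂ) * (2 * Real.pi * I) = k * (2 * Real.pi * I) * n := by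
      have this : ((2 : ℕ) : ℂ) * (2 * Real.pi * I / n) * n = k * (2 * Real.pi * I) * n :=
        congrArg (fun z : ℂ => z * n) hk
      rw [mul_assoc ((2 : ℕ) : ℂ), div_mul_cancel₀ _ hn0] at this
      exact this
    have h4 : (2 * Real.pi * I : ℂ) * 2 = (2 * Real.pi * I) * (k * n) := by
      have h22 : ((2 : ℕ) : ℂ) = 2 := by norm_num
      rw [h22] at h3
      linear_combination h3
    have hkn : (k : ℂ) * n = 2 := (mul_left_cancel₀ h2 h4).symm
    have hkz : k * (n : ℤ) = 2 := by exact_mod_cast hkn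
    have hk1 : 1 ≤ k := by
      by_contra hk'
      have hk0 : k ≤ 0 := by omega
      have : k * (n : ℤ) ≤ 0 := mul_nonpos_of_nonpos_of_nonneg hk0 (by positivity)
      omega
    have h5 : (n : ℤ) ≤ k * n := le_mul_of_one_le_left (by positivity) hk1
    omega
  set c : Matrix.specialUnitaryGroup (Fin n) ℂ := ⟨ζ ^ 1 • 1, rootOfUnity_smul_one_mem (by omega) 1⟩
    with hcdef
  have key := integral_mul_left_eq_self (μ := μ)
    (fun U : Matrix.specialUnitaryGroup (Fin n) ℂ => ((U : Matrix (Fin n) (Fin n) ℂ)).trace ^ 2) c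
  have hmul : ∀ U : Matrix.specialUnitaryGroup (Fin n) ℂ,
      (((c * U : Matrix.specialUnitaryGroup (Fin n) ℂ) : Matrix (Fin n) (Fin n) ℂ)).trace =
        ζ * ((U : Matrix (Fin n) (Fin n) ℂ)).trace := fun U => by
    show ((ζ ^ 1 • (1 : Matrix (Fin n) (Fin n) ℂ)) * (U : Matrix (Fin n) (Fin n) ℂ)).trace = _
    rw [pow_one, Matrix.smul_mul, one_mul, Matrix.trace_smul, smul_eq_mul]
  simp only [hmul, mul_pow] at key
  rw [integral_const_mul] at key
  have : (ζ ^ 2 - 1) * ∫ U, ((U : Matrix (Fin n) (Fin n) ℂ)).trace ^ 2 ∂μ = 0 := by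
    rw [sub_mul, one_mul, key, sub_self]
  exact (mul_eq_zero.mp this).resolve_left (sub_ne_zero.mpr hζ2)

/-- **`m₂(n) = ∫_{SU(n)} (Re tr U)² dU = ½` for `n ≥ 3`** (`(Re z)² = (|z|² + Re z²)/2`). [ours] -/
theorem haarSqReTrace_eq_half (hn : 3 ≤ n) :
    ∫ g, ((g : Matrix (Fin n) (Fin n) ℂ)).trace.re ^ 2
      ∂(haarProbability (Matrix.specialUnitaryGroup (Fin n) ℂ)) = 1 / 2 := by
  set μ := haarProbability (Matrix.specialUnitaryGroup (Fin n) ℂ) with hμ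
  have htr : Continuous fun g : Matrix.specialUnitaryGroup (Fin n) ℂ =>
      ((g : Matrix (Fin n) (Fin n) ℂ)).trace := continuous_subtype_val.matrix_trace
  have h1 : Integrable (fun g : Matrix.specialUnitaryGroup (Fin n) ℂ =>
      Complex.normSq ((g : Matrix (Fin n) (Fin n) ℂ)).trace) μ :=
    integrable_haarSU_of_continuous_real (Complex.continuous_normSq.comp htr)
  have h3 : Integrable (fun g : Matrix.specialUnitaryGroup (Fin n) ℂ =>
      ((g : Matrix (Fin n) (Fin n) ℂ)).trace ^ 2) μ :=
    integrable_haarSU_of_continuous (htr.pow 2)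
  have h2 : Integrable (fun g : Matrix.specialUnitaryGroup (Fin n) ℂ =>
      (((g : Matrix (Fin n) (Fin n) ℂ)).trace ^ 2).re) μ := h3.re
  have hpt : ∀ g : Matrix.specialUnitaryGroup (Fin n) ℂ,
      ((g : Matrix (Fin n) (Fin n) ℂ)).trace.re ^ 2 =
        (1 / 2 : ℝ) * (Complex.normSq ((g : Matrix (Fin n) (Fin n) ℂ)).trace +
          (((g : Matrix (Fin n) (Fin n) ℂ)).trace ^ 2).re) := fun g => by
    rw [Complex.normSq_apply, pow_two, pow_two, Complex.mul_re]
    ring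
  simp_rw [hpt]
  rw [integral_const_mul, integral_add h1 h2, integral_normSq_trace (by omega),
    ← complex_re_integral_eq h3, integral_trace_sq_eq_zero hn, Complex.zero_re]
  norm_num

end Haar

/-! ## The explicit volume-uniform Fisher-zero disc for `SU(n)`, `n ≥ 3` -/

section Wilson

variable {d L n : ℕ} [NeZero L]

/-- **Every finite-volume `SU(n)` Wilson partition function (`n ≥ 3`, `d ≥ 2`, every `L ≥ 2`) has a
Fisher zero with `|s₀| < 512(2n+1)`.** [ours] -/
theorem wilson_sun_exists_fisherZero_norm_lt (hd : 2 ≤ d) (hn : 3 ≤ n) (hL : 2 ≤ L) :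
    ∃ s₀ : ℂ, ‖s₀‖ < 512 * (2 * n + 1) ∧
      complexMGF (fun U => -ambWilsonAction (coeConfig U))
        (trivialMeasure (Matrix.specialUnitaryGroup (Fin n) ℂ) d L) s₀ = 0 := by
  obtain ⟨s₀, hs₀, hz⟩ :=
    wilson_exists_fisherZero_norm_lt_uniform (d := d) (L := L) (n := n) hd (by omega) hL
  refine ⟨s₀, ?_, hz⟩
  rw [haarSqReTrace_eq_half hn] at hs₀
  have h : max (1 : ℝ) (256 * (2 * n + 1) / (1 / 2)) = 512 * (2 * n + 1) := by
    rw [max_eq_right] <;> [ring; (have : (0:ℝ) ≤ n := Nat.cast_nonneg n; linarith)]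
  rwa [h] at hs₀

/-- **Lüscher's volume-uniform radius for `SU(n)`, `n ≥ 3`, is at most `512(2n+1)`.** [ours] -/
theorem wilson_sun_theoremA_radius_le (hd : 2 ≤ d) (hn : 3 ≤ n) {ρ C : ℝ} (hρ : 0 < ρ)
    (hA : ∀ (L : ℕ) [NeZero L] (B : SuBasis n) (Sk : ℕ → AmbConfig d L n → ℝ) (c : ℕ → ℝ),
      (∀ k, ContDiff ℝ ∞ (Sk k)) → IsLuscherSeries B ambWilsonAction Sk c →
      ∀ (k : ℕ) (U : GaugeConfig d L (Matrix.specialUnitaryGroup (Fin n) ℂ)) (e : Edge d L)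
        (a : B.ι), |linkDeriv e (B.T a) (Sk k) (coeConfig U)| ≤ C * ρ⁻¹ ^ k)
    (B : SuBasis n) : ρ ≤ 512 * (2 * n + 1) := by
  have h := wilson_theoremA_radius_le_uniform (d := d) (n := n) hd (by omega) hρ hA B
  rw [haarSqReTrace_eq_half hn] at h
  have h' : max (1 : ℝ) (256 * (2 * n + 1) / (1 / 2)) = 512 * (2 * n + 1) := by
    rw [max_eq_right] <;> [ring; (have : (0:ℝ) ≤ n := Nat.cast_nonneg n; linarith)]
  rwa [h'] at h

end Wilson

end Summit.Ventures.LatticeQCDFlow.TrivializingMaps
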